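import Summits.CriticalPhenomena.Ising3D.TaylorTableIdentity
import Summits.CriticalPhenomena.Ising3D.TaylorOddConeHeadQPoly
import Mathlib.Tactic.Linarith
import Mathlib.Tactic.Positivity
import Mathlib.Tactic.Ring
import HarnessLib

/-!
# The TABLE layer of a derivative certificate, IV: an odd head cell (corrected head, (D5b)) from a kd-tree check
(cell `pub-ising3x`, seat boot-1 gen 6; gate (g2) — the per-cell hypothesis `hhead` of
`TaylorConeObligations.of_oddCover` for the concrete functional at `(½,½)`, in POLYBOX form)

HONEST FRAMING: lottery ticket; floor = tightest certified 3D Ising CFT bounds; no exact-solution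
claim without a proof.

On an odd head cell (spin `ℓ`, `Δ ∈ [lo, hi]` with `ℓ ≤ lo`, head list `F`, `j ≤ ℓ + n` on `F`) the obligation
`0 ≤ Σ_{q∈F} oddConeHeadValue α Ψ κ₀ Δσ Δε Δ ℓ q` for `α = taylorCrossing ½ ½ S w`, `Ψ = Σ ψ(a,b) taylorCoeffAt ½ ½ (a,b)`
is, by `sum_oddConeHeadValue_half_nonneg_iff`, the sign of `Σ_{q∈F} (½)^n B(n,j)` with the bracket
`B = (-1)^ℓ cₛ κ q̂₃ + c₊ (q̂₄ - q̂₅) + (κ₀⁻¹/2)(c₋ μσ ψ̂₀ - c₊ με ψ̂_t)` (`TaylorOddConeHeadQPoly`): POLYNOMIAL in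
`(Δσ, Δε, Δ)` and LINEAR in the enclosure variables `κ = (½)^{Δε-Δσ}`, `μσ = (½)^{-2Δσ}`, `με = (½)^{-2Δε}`
(decidable rational enclosures, `half_rpow_mem_of_checks`) and, per head term, the three Dolan–Osborn
coefficient values `cₛ = A_{n,j}(-t/2,t/2)/λ_ℓ`, `c₊ = A_{n,j}(t/2,t/2)/λ_ℓ`, `c₋ = A_{n,j}(-t/2,-t/2)/λ_ℓ`
(`t = Δσ - Δε`; enclosures valid on cell × box are a HYPOTHESIS, discharged by the `HRCoeffAB*` tables of the
Literature layer or a reader's interval recursion). Variables: `x₀ = Δσ, x₁ = Δε, x₂ = Δ, x₃ = κ, x₄ = μσ,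
x₅ = με, x_{6+3i}, x_{7+3i}, x_{8+3i} = cₛ, c₊, c₋` of head term `i`. `oddHead_nonneg_of_kdCheck`: enclosures +
one accepted kd-tree certificate of `-bracketSum ≤ 0` ⇒ the cell obligation at every point of box × cell.
Sources: Kos–Poland–Simmons-Duffin 2014 §3.3 eq. (3.16); Dolan–Osborn 2004 §3 eq. (3.11). Elementary.
-/

namespace Summit.CriticalPhenomena.Ising3D

open Finset Set
open Literature.MathematicalPhysics.QuantumFieldTheory.ConformalBootstrap3D
open Literature.Analysis.ValidatedNumerics

/-! ### Lists of triples, flattened (variables and box entries of the head terms) -/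

/-- Flatten a list of triples. [folklore] -/
def flat3 {β : Type*} : List (β × β × β) → List β
  | [] => []
  | t :: ts => t.1 :: t.2.1 :: t.2.2 :: flat3 ts

/-- Entry `3i + r` of a flattened list of triples. [folklore] -/
theorem getD_flat3 {β : Type*} (d : β) :
    ∀ (ts : List (β × β × β)) (i : ℕ) (t : β × β × β), ts[i]? = some t →
      (flat3 ts).getD (3 * i) d = t.1 ∧ (flat3 ts).getD (3 * i + 1) d = t.2.1 ∧
        (flat3 ts).getD (3 * i + 2) d = t.2.2
  | [], i, t, h => by simp at h
  | t₀ :: ts, 0, t, h => by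
    simp only [List.getElem?_cons_zero, Option.some.injEq] at h
    subst h
    simp [flat3]
  | t₀ :: ts, i + 1, t, h => by
    have h' : ts[i]? = some t := by simpa using h
    obtain ⟨h1, h2, h3⟩ := getD_flat3 d ts i t h'
    refine ⟨?_, ?_, ?_⟩
    · rw [show 3 * (i + 1) = 3 * i + 3 by ring]; simpa [flat3] using h1
    · rw [show 3 * (i + 1) + 1 = 3 * i + 1 + 3 by ring]; simpa [flat3] using h2
    · rw [show 3 * (i + 1) + 2 = 3 * i + 2 + 3 by ring]; simpa [flat3] using h3

/-- Beyond `3 · length` a flattened list of triples returns the default. [folklore] -/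
theorem getD_flat3_of_le {β : Type*} (d : β) :
    ∀ (ts : List (β × β × β)) (n : ℕ), 3 * ts.length ≤ n → (flat3 ts).getD n d = d
  | [], n, _ => by simp [flat3]
  | t :: ts, n, h => by
    obtain ⟨m, rfl⟩ : ∃ m, n = m + 3 := ⟨n - 3, by simp at h; omega⟩
    simp only [flat3, List.getD_cons_succ]
    exact getD_flat3_of_le d ts m (by simp at h; omega)

/-- Every index below `3 · length` is `3i + r` with `r < 3` and `i` in range. [folklore] -/
theorem exists_eq_three_mul_add (m n : ℕ) (h : n < 3 * m) : ∃ i r, i < m ∧ r < 3 ∧ n = 3 * i + r :=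
  ⟨n / 3, n % 3, by omega, Nat.mod_lt _ (by norm_num), by omega⟩

/-! ### Head sums with three enclosure variables per head term -/

/-- `Σ_i term (k + 3i) qᵢ` over `qs = [q₀, q₁, …]` (the term of entry `i` may use the variables
`k+3i, k+3i+1, k+3i+2`). [folklore] -/
def headSum3Expr (term : ℕ → ℕ × ℕ → ArithExpr) : ℕ → List (ℕ × ℕ) → ArithExpr
  | _, [] => .const 0
  | k, q :: qs => .add (term k q) (headSum3Expr term (k + 3) qs)

/-- Evaluation of `headSum3Expr` from a pointwise evaluation of the terms. [folklore] -/
theorem eval_headSum3Expr (x : ℕ → ℝ) (term : ℕ → ℕ × ℕ → ArithExpr) (f : ℕ × ℕ → ℝ) :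
    ∀ (k : ℕ) (qs : List (ℕ × ℕ)),
      (∀ (i : ℕ) (q : ℕ × ℕ), qs[i]? = some q → (term (k + 3 * i) q).eval x = f q) →
      (headSum3Expr term k qs).eval x = (qs.map f).sum
  | _, [], _ => by simp [headSum3Expr]
  | k, q :: qs, hx => by
    rw [headSum3Expr, ArithExpr.eval_add, List.map_cons, List.sum_cons]
    have h0 : (term k q).eval x = f q := by simpa using hx 0 q rfl
    rw [h0, eval_headSum3Expr x term f (k + 3) qs fun i q' hq' => by
      rw [show k + 3 + 3 * i = k + 3 * (i + 1) by ring]; exact hx (i + 1) q' (by simpa using hq')]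

/-! ### The bracket sum as an expression -/

/-- The term `(½)^n · B(n,j)` of the odd head bracket sum as an expression, the three coefficients read off
the variables `k, k+1, k+2` (weights `c` on `L`, majorant weights `ψ` on `Lψ`, weight `κ₀`, spin `ℓ`).
[folklore] -/
def oddBracketTermExpr (c : Fin 5 → ℕ × ℕ → ℚ) (L : List (ℕ × ℕ)) (ψ : ℕ × ℕ → ℚ) (Lψ : List (ℕ × ℕ))
    (κ₀ : ℚ) (ℓ : ℕ) (k : ℕ) (q : ℕ × ℕ) : ArithExpr :=
  let eE : ArithExpr := .add (.var 2) (.const q.1)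
  let sbar : ArithExpr := .mul (.add (.var 0) (.var 1)) (.const (1 / 2))
  .mul (.const (1 / 2 ^ q.1))
    (.add (.add
      (.mul (.const ((-1) ^ ℓ)) (.mul (.var k) (.mul (.var 3) (qSumExpr (c 2) L sbar (-1) eE q.2))))
      (.mul (.var (k + 1)) (.sub (qSumExpr (c 3) L (.var 0) (-1) eE q.2) (qSumExpr (c 4) L (.var 0) 1 eE q.2))))
      (.mul (.const (κ₀⁻¹ / 2))
        (.sub (.mul (.var (k + 2)) (.mul (.var 4) (qSumExpr ψ Lψ (.const 0) 0 eE q.2)))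
          (.mul (.var (k + 1)) (.mul (.var 5) (qSumExpr ψ Lψ (.sub (.var 0) (.var 1)) 0 eE q.2))))))

/-- The bracket sum `Σ_{q∈F} (½)^n B(n,j)` as an expression. [folklore] -/
def oddBracketSumExpr (c : Fin 5 → ℕ × ℕ → ℚ) (L : List (ℕ × ℕ)) (ψ : ℕ × ℕ → ℚ) (Lψ : List (ℕ × ℕ))
    (κ₀ : ℚ) (ℓ : ℕ) (F : List (ℕ × ℕ)) : ArithExpr :=
  headSum3Expr (oddBracketTermExpr c L ψ Lψ κ₀ ℓ) 6 F

/-- The three Dolan–Osborn coefficient values of a head term: `(cₛ, c₊, c₋)`. [folklore] -/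
noncomputable def oddCoeffs (Δσ Δε Δ : ℝ) (ℓ : ℕ) (q : ℕ × ℕ) : ℝ × ℝ × ℝ :=
  (hrCoeffAB (-(Δσ - Δε) / 2) ((Δσ - Δε) / 2) Δ ℓ q.1 q.2 / legendreLam ℓ,
    hrCoeffAB ((Δσ - Δε) / 2) ((Δσ - Δε) / 2) Δ ℓ q.1 q.2 / legendreLam ℓ,
    hrCoeffAB (-(Δσ - Δε) / 2) (-(Δσ - Δε) / 2) Δ ℓ q.1 q.2 / legendreLam ℓ)

/-- The point `(Δσ, Δε, Δ, κ, μσ, με, cₛ⁰, c₊⁰, c₋⁰, cₛ¹, …)` fed to the bracket sum. [folklore] -/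
noncomputable def oddHeadPoint (ℓ : ℕ) (F : List (ℕ × ℕ)) (Δσ Δε Δ : ℝ) : ℕ → ℝ
  | 0 => Δσ
  | 1 => Δε
  | 2 => Δ
  | 3 => (1 / 2 : ℝ) ^ (Δε - Δσ)
  | 4 => (1 / 2 : ℝ) ^ (-(2 * Δσ))
  | 5 => (1 / 2 : ℝ) ^ (-(2 * Δε))
  | n + 6 => (flat3 (F.map (oddCoeffs Δσ Δε Δ ℓ))).getD n 0

/-- The head variables hold the coefficient values. [folklore] -/
theorem oddHeadPoint_vars (ℓ : ℕ) (F : List (ℕ × ℕ)) (Δσ Δε Δ : ℝ) (i : ℕ) (q : ℕ × ℕ)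
    (h : F[i]? = some q) :
    oddHeadPoint ℓ F Δσ Δε Δ (6 + 3 * i) = (oddCoeffs Δσ Δε Δ ℓ q).1 ∧
      oddHeadPoint ℓ F Δσ Δε Δ (6 + 3 * i + 1) = (oddCoeffs Δσ Δε Δ ℓ q).2.1 ∧
      oddHeadPoint ℓ F Δσ Δε Δ (6 + 3 * i + 2) = (oddCoeffs Δσ Δε Δ ℓ q).2.2 := by
  have hm : (F.map (oddCoeffs Δσ Δε Δ ℓ))[i]? = some (oddCoeffs Δσ Δε Δ ℓ q) := by
    rw [List.getElem?_map, h]; rfl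
  obtain ⟨h1, h2, h3⟩ := getD_flat3 (0 : ℝ) _ i _ hm
  refine ⟨?_, ?_, ?_⟩
  · rw [show 6 + 3 * i = 3 * i + 6 by ring]; simpa [oddHeadPoint] using h1
  · rw [show 6 + 3 * i + 1 = (3 * i + 1) + 6 by ring]; simpa [oddHeadPoint] using h2
  · rw [show 6 + 3 * i + 2 = (3 * i + 2) + 6 by ring]; simpa [oddHeadPoint] using h3

/-- Evaluation of one bracket term at the head point. [folklore] -/
theorem eval_oddBracketTermExpr (c : Fin 5 → ℕ × ℕ → ℚ) {L : List (ℕ × ℕ)} (hL : L.Nodup)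
    (ψ : ℕ × ℕ → ℚ) {Lψ : List (ℕ × ℕ)} (hLψ : Lψ.Nodup) (κ₀ : ℚ) (ℓ : ℕ) (F : List (ℕ × ℕ))
    (Δσ Δε Δ : ℝ) (i : ℕ) (q : ℕ × ℕ) (h : F[i]? = some q) :
    (oddBracketTermExpr c L ψ Lψ κ₀ ℓ (6 + 3 * i) q).eval (oddHeadPoint ℓ F Δσ Δε Δ) =
      (1 / 2 : ℝ) ^ q.1 * oddConeHeadBracket L.toFinset (fun k ab => (c k ab : ℝ)) Lψ.toFinset
        (fun ab => (ψ ab : ℝ)) κ₀ Δσ Δε Δ ℓ q := by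
  obtain ⟨h1, h2, h3⟩ := oddHeadPoint_vars ℓ F Δσ Δε Δ i q h
  simp only [oddBracketTermExpr, ArithExpr.eval_mul, ArithExpr.eval_add, ArithExpr.eval_sub,
    ArithExpr.eval_const, ArithExpr.eval_var, eval_qSumExpr _ _ hL, eval_qSumExpr _ _ hLψ, h1, h2, h3]
  simp only [oddHeadPoint, oddCoeffs, oddConeHeadBracket]
  push_cast
  simp only [one_div, inv_pow]
  ring

/-- **Evaluation of the bracket sum** at the head point: the list sum `Σ_{q∈F} (½)^n B(n,j)`. [folklore] -/
theorem eval_oddBracketSumExpr (c : Fin 5 → ℕ × ℕ → ℚ) {L : List (ℕ × ℕ)} (hL : L.Nodup)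
    (ψ : ℕ × ℕ → ℚ) {Lψ : List (ℕ × ℕ)} (hLψ : Lψ.Nodup) (κ₀ : ℚ) (ℓ : ℕ) (F : List (ℕ × ℕ))
    (Δσ Δε Δ : ℝ) :
    (oddBracketSumExpr c L ψ Lψ κ₀ ℓ F).eval (oddHeadPoint ℓ F Δσ Δε Δ) =
      (F.map fun q => (1 / 2 : ℝ) ^ q.1 * oddConeHeadBracket L.toFinset (fun k ab => (c k ab : ℝ))
        Lψ.toFinset (fun ab => (ψ ab : ℝ)) κ₀ Δσ Δε Δ ℓ q).sum :=
  eval_headSum3Expr _ _ _ 6 F fun i q hq => eval_oddBracketTermExpr c hL ψ hLψ κ₀ ℓ F Δσ Δε Δ i q hq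

/-! ### The box and the table theorem -/

/-- The odd head box: `[σlo,σhi] × [εlo,εhi] × [lo,hi] × [klo,khi] × [mσlo,mσhi] × [mεlo,mεhi] × Π_i (cₛ, c₊, c₋)`-boxes.
[folklore] -/
def oddHeadBox (σlo σhi εlo εhi lo hi klo khi mσlo mσhi mεlo mεhi : ℚ)
    (A : List ((ℚ × ℚ) × (ℚ × ℚ) × (ℚ × ℚ))) : Box :=
  (σlo, σhi) :: (εlo, εhi) :: (lo, hi) :: (klo, khi) :: (mσlo, mσhi) :: (mεlo, mεhi) :: flat3 A

/-- **TABLE THEOREM, odd head cell (corrected head of (D5b)).** For rational weights `c` on `L`, majorant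
weights `ψ` on `Lψ`, `κ₀`, an odd head cell (spin `ℓ`, `Δ`-interval `[lo, hi]` with `ℓ ≤ lo`, head list `F` with
`j ≤ ℓ + n`), decidable enclosures of `κ = (½)^{Δε-Δσ}`, `μσ = (½)^{-2Δσ}`, `με = (½)^{-2Δε}` over the box,
enclosures `A` of the three coefficient values of every head term valid on box × cell, and an accepted kd-tree
certificate of `-(bracket sum) ≤ 0` on the odd head box: `0 ≤ Σ_{q∈F} oddConeHeadValue` at every point of
box × cell. [cite: KosPolandSimmonsduffin2014, §3.3 eq. (3.16)] -/
theorem oddHead_nonneg_of_kdCheck (c : Fin 5 → ℕ × ℕ → ℚ) {L : List (ℕ × ℕ)} (hL : L.Nodup)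
    (ψ : ℕ × ℕ → ℚ) {Lψ : List (ℕ × ℕ)} (hLψ : Lψ.Nodup) (κ₀ : ℚ) (ℓ : ℕ)
    {F : List (ℕ × ℕ)} (hF : F.Nodup) (hFj : ∀ q ∈ F, q.2 ≤ ℓ + q.1)
    {σlo σhi εlo εhi lo hi : ℚ} (hℓlo : (ℓ : ℚ) ≤ lo)
    -- κ = (½)^{Δε-Δσ}
    {r₁ r₂ klo khi : ℚ} (hkhi : 0 < khi) (hr₁ : r₁ ≤ εlo - σhi) (hr₂ : εhi - σlo ≤ r₂)
    (hk₁ : klo ^ r₂.den ≤ (1 / 2 : ℚ) ^ (r₂.num : ℤ)) (hk₂ : (1 / 2 : ℚ) ^ (r₁.num : ℤ) ≤ khi ^ r₁.den)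
    -- μσ = (½)^{-2Δσ}
    {u₁ u₂ mσlo mσhi : ℚ} (hmσhi : 0 < mσhi) (hu₁ : u₁ ≤ -(2 * σhi)) (hu₂ : -(2 * σlo) ≤ u₂)
    (hmσ₁ : mσlo ^ u₂.den ≤ (1 / 2 : ℚ) ^ (u₂.num : ℤ)) (hmσ₂ : (1 / 2 : ℚ) ^ (u₁.num : ℤ) ≤ mσhi ^ u₁.den)
    -- με = (½)^{-2Δε}
    {v₁ v₂ mεlo mεhi : ℚ} (hmεhi : 0 < mεhi) (hv₁ : v₁ ≤ -(2 * εhi)) (hv₂ : -(2 * εlo) ≤ v₂)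
    (hmε₁ : mεlo ^ v₂.den ≤ (1 / 2 : ℚ) ^ (v₂.num : ℤ)) (hmε₂ : (1 / 2 : ℚ) ^ (v₁.num : ℤ) ≤ mεhi ^ v₁.den)
    -- coefficient enclosures per head term, valid on box × cell
    {A : List ((ℚ × ℚ) × (ℚ × ℚ) × (ℚ × ℚ))} (hA : A.length = F.length)
    (henc : ∀ p ∈ Icc (σlo : ℝ) σhi ×ˢ Icc (εlo : ℝ) εhi, ∀ Δ : ℝ, (lo : ℝ) ≤ Δ → Δ ≤ hi →
      ∀ (i : ℕ) (q : ℕ × ℕ) (I : (ℚ × ℚ) × (ℚ × ℚ) × (ℚ × ℚ)), F[i]? = some q → A[i]? = some I →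
        ((I.1.1 : ℝ) ≤ (oddCoeffs p.1 p.2 Δ ℓ q).1 ∧ (oddCoeffs p.1 p.2 Δ ℓ q).1 ≤ (I.1.2 : ℝ)) ∧
        ((I.2.1.1 : ℝ) ≤ (oddCoeffs p.1 p.2 Δ ℓ q).2.1 ∧ (oddCoeffs p.1 p.2 Δ ℓ q).2.1 ≤ (I.2.1.2 : ℝ)) ∧
        ((I.2.2.1 : ℝ) ≤ (oddCoeffs p.1 p.2 Δ ℓ q).2.2 ∧ (oddCoeffs p.1 p.2 Δ ℓ q).2.2 ≤ (I.2.2.2 : ℝ)))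
    {t : KdCert ℕ}
    (ht : t.check (exprLeOn (.neg (oddBracketSumExpr c L ψ Lψ κ₀ ℓ F)) 0)
      (oddHeadBox σlo σhi εlo εhi lo hi klo khi mσlo mσhi mεlo mεhi A) = true) :
    ∀ p ∈ Icc (σlo : ℝ) σhi ×ˢ Icc (εlo : ℝ) εhi, ∀ Δ : ℝ, (lo : ℝ) ≤ Δ → Δ ≤ hi →
      0 ≤ ∑ q ∈ F.toFinset, oddConeHeadValue (taylorCrossing (1 / 2) (1 / 2) L.toFinset (fun k ab => (c k ab : ℝ)))
        (∑ ab ∈ Lψ.toFinset, (ψ ab : ℝ) • taylorCoeffAt (1 / 2) (1 / 2) ab) κ₀ p.1 p.2 Δ ℓ q := by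
  intro p hp Δ hlo hhi
  obtain ⟨⟨hσ1, hσ2⟩, ⟨hε1, hε2⟩⟩ := hp
  have hℓΔ : (ℓ : ℝ) ≤ Δ := by
    have : ((ℓ : ℚ) : ℝ) ≤ (lo : ℝ) := by exact_mod_cast hℓlo
    push_cast at this
    linarith
  -- the three transcendental enclosures
  have hr₁' : (r₁ : ℝ) ≤ (εlo : ℝ) - (σhi : ℝ) := by exact_mod_cast hr₁
  have hr₂' : (εhi : ℝ) - (σlo : ℝ) ≤ (r₂ : ℝ) := by exact_mod_cast hr₂
  have hκ := half_rpow_mem_of_checks hkhi hk₁ hk₂ (t := p.2 - p.1) (by linarith) (by linarith)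
  have hu₁' : (u₁ : ℝ) ≤ -(2 * (σhi : ℝ)) := by exact_mod_cast hu₁
  have hu₂' : -(2 * (σlo : ℝ)) ≤ (u₂ : ℝ) := by exact_mod_cast hu₂
  have hμσ := half_rpow_mem_of_checks hmσhi hmσ₁ hmσ₂ (t := -(2 * p.1)) (by linarith) (by linarith)
  have hv₁' : (v₁ : ℝ) ≤ -(2 * (εhi : ℝ)) := by exact_mod_cast hv₁
  have hv₂' : -(2 * (εlo : ℝ)) ≤ (v₂ : ℝ) := by exact_mod_cast hv₂
  have hμε := half_rpow_mem_of_checks hmεhi hmε₁ hmε₂ (t := -(2 * p.2)) (by linarith) (by linarith)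
  -- membership of the head point in the head box
  have hmem : (oddHeadBox σlo σhi εlo εhi lo hi klo khi mσlo mσhi mεlo mεhi A).mem
      (oddHeadPoint ℓ F p.1 p.2 Δ) := by
    intro n
    match n with
    | 0 => exact ⟨hσ1, hσ2⟩
    | 1 => exact ⟨hε1, hε2⟩
    | 2 => exact ⟨hlo, hhi⟩
    | 3 => exact hκ
    | 4 => exact hμσ
    | 5 => exact hμε
    | m + 6 =>
      simp only [oddHeadBox, Box.ivl, List.getD_cons_succ]
      by_cases hm : m < 3 * F.length
      · obtain ⟨i, r, hi, hr, rfl⟩ := exists_eq_three_mul_add _ _ hm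
        obtain ⟨q, hq⟩ : ∃ q, F[i]? = some q := ⟨F[i], List.getElem?_eq_getElem hi⟩
        have hiA : i < A.length := hA ▸ hi
        have hI : A[i]? = some A[i] := List.getElem?_eq_getElem hiA
        obtain ⟨e1, e2, e3⟩ := henc p ⟨⟨hσ1, hσ2⟩, ⟨hε1, hε2⟩⟩ Δ hlo hhi i q _ hq hI
        obtain ⟨b1, b2, b3⟩ := getD_flat3 ((0 : ℚ), (0 : ℚ)) A i _ hI
        obtain ⟨v1, v2, v3⟩ := oddHeadPoint_vars ℓ F p.1 p.2 Δ i q hq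
        interval_cases r
        · rw [Nat.add_zero, b1, show 3 * i + 6 = 6 + 3 * i by ring, v1]; exact e1
        · rw [b2, show 3 * i + 1 + 6 = 6 + 3 * i + 1 by ring, v2]; exact e2
        · rw [b3, show 3 * i + 2 + 6 = 6 + 3 * i + 2 by ring, v3]; exact e3
      · rw [getD_flat3_of_le _ A m (by rw [hA]; omega)]
        simp only [oddHeadPoint]
        rw [getD_flat3_of_le _ _ m (by simpa using not_lt.mp hm)]
        simp
  have h := nonneg_of_kdCheck_neg ht _ hmem
  rw [eval_oddBracketSumExpr c hL ψ hLψ κ₀ ℓ F] at h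
  -- back to the Finset statement
  have hFj' : ∀ q ∈ F.toFinset, (q.2 : ℝ) ≤ Δ + (q.1 : ℝ) := by
    intro q hq
    have h1 : q.2 ≤ ℓ + q.1 := hFj q (List.mem_toFinset.mp hq)
    have : (q.2 : ℝ) ≤ (ℓ : ℝ) + (q.1 : ℝ) := by exact_mod_cast h1
    linarith
  rw [sum_oddConeHeadValue_half_nonneg_iff _ _ _ _ _ _ _ _ _ _ hFj', List.sum_toFinset _ hF]
  simpa [Real.rpow_natCast] using h

end Summit.CriticalPhenomena.Ising3D
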